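import Mathlib
import Literature.RingTheory.MvPolynomial.BuchbergerCriterion

/-!
# Homogenization of polynomials and ideals; the projective closure
# (Cox–Little–O'Shea, Ch. 8 §2 Prop. 7 and §4)

We formalise the algebra behind the projective closure of an affine variety,
[CoxLittleOShea2007, Ch. 8 §2 Proposition 7 and §4]:

* `homogenization f = f^h ∈ k[x₀, x₁, …, xₙ]` — here `MvPolynomial (Option σ) R`, the new variable
  `x₀` being `X none` — of `f ∈ k[x₁, …, xₙ] = MvPolynomial σ R`:
  `f^h = ∑_α c_α x^α x₀^{d - |α|}`, `d = deg f` (§2 Prop. 7); more generally `homogenizeTo d f =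
  x₀^{d - deg f} f^h`, the homogenization "padded to degree `d ≥ deg f`";
* `dehomogenization F = F(1, x₁, …, xₙ)` (an `R`-algebra map);
* §2 Prop. 7: `f^h` is homogeneous of degree `deg f` (i), `f^h (1, x) = f` (iii), and a homogeneous
  `F` of degree `d` equals `x₀^{d - deg F(1,x)} · (F(1, x))^h` (iv). The engine behind (iv) and
  behind all the algebra below is `eq_of_dehomogenization_eq`: **a homogeneous
  polynomial of given degree is determined by its dehomogenization**; from it, `homogenizeTo d` is
  additive and multiplicative (`homogenizeTo_add`, `homogenizeTo_sum`, `homogenizeTo_mul`,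
  `homogenization_mul` over a domain);
* §4 Def. 1: the homogenization `idealHomogenization I = I^h = ⟨f^h : f ∈ I⟩` of an ideal;
  Prop. 2: `I^h` is a homogeneous ideal; dehomogenizing `I^h` gives back `I`, and a HOMOGENEOUS
  `F` lies in `I^h` iff `F(1, x) ∈ I` (`mem_idealHomogenization_iff`);
* §4 Example 3 (the affine twisted cubic): homogenizing the generators of
  `I = ⟨x₂ - x₁², x₃ - x₁³⟩` gives an ideal `J = ⟨x₂x₀ - x₁², x₃x₀² - x₁³⟩` STRICTLY smaller than
  `I^h`: `x₀x₃ - x₁x₂ ∈ I^h ∖ J` (`twistedCubicHomogenizedSpan_lt`);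
* §4 Theorem 4: if `G` is a Gröbner basis of `I` for a GRADED monomial order (`IsGradedOrder`:
  `a ≼ b → |a| ≤ |b|`, e.g. `degLex`), then `G^h = {g^h : g ∈ G}` generates `I^h`
  (`idealHomogenization_eq_span_of_isGroebnerBasis`);
* §4 Prop. 7 (i) in coordinates: the affine part of `V(I^h)` is `V(I)`, i.e. for `a ∈ kⁿ`,
  every `F ∈ I^h` vanishes at `(1 : a)` iff every `f ∈ I` vanishes at `a`
  (`forall_eval_one_eq_zero_iff`); and at infinity, `f^h (0, x)` is the top homogeneous
  component of `f` (`aeval_zero_homogenization`).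

Gröbner bases are the tree's `Literature.RingTheory.MvPolynomial.BuchbergerCriterion`
(`IsGroebnerBasis`, `isGroebnerBasis_iff`); division is Mathlib's `MonomialOrder.div_set`.
Not covered here: the monomial order `>_h` and Lemma 5 (`G^h` is even a Gröbner basis of `I^h`),
Theorem 8 (over an algebraically closed field `V(I^h)` is the projective closure of `V(I)`), and
projective space itself — Prop. 7 (i) is stated in the affine chart `x₀ = 1`.
-/

open MvPolynomial
open scoped MonomialOrder
open Literature.RingTheory.MvPolynomial.BuchbergerCriterion (IsGroebnerBasis isGroebnerBasis_iff)

namespace Literature.RingTheory.MvPolynomial.IdealHomogenization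

section CommSemiring

variable {σ : Type*} {R : Type*} [CommSemiring R]

/-! ## Exponents in `k[x₀, x₁, …, xₙ]`: `|β| = β₀ + |β'|` -/

/-- The total degree of an exponent of `k[x₀, …, xₙ]` is its `x₀`-exponent plus the total degree
of its `x₁ … xₙ`-part. [cite: CoxLittleOShea2007, Ch.8 §2 Prop. 7] -/
theorem degree_eq_none_add_degree_some (β : Option σ →₀ ℕ) :
    β.degree = β none + β.some.degree := by
  rw [Finsupp.degree_apply, Finsupp.degree_apply]
  exact Finsupp.sum_option_index β (fun _ n => n) (fun _ => rfl) (fun _ _ _ => rfl)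

/-- The exponent `x^γ x₀^y` has total degree `y + |γ|`.
[cite: CoxLittleOShea2007, Ch.8 §2 Prop. 7] -/
theorem degree_optionElim_eq_add (y : ℕ) (γ : σ →₀ ℕ) : (γ.optionElim y).degree = y + γ.degree := by
  rw [degree_eq_none_add_degree_some, Finsupp.optionElim_apply_none, Finsupp.some_optionElim]

/-- An exponent `β` of total degree `d` is `x^{β'} x₀^{d - |β'|}` with `β'` its `x₁ … xₙ`-part.
[cite: CoxLittleOShea2007, Ch.8 §2 Prop. 7] -/
theorem eq_optionElim_of_degree_eq {β : Option σ →₀ ℕ} {d : ℕ} (h : β.degree = d) :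
    β = β.some.optionElim (d - β.some.degree) := by
  have h' : β none = d - β.some.degree := by
    rw [degree_eq_none_add_degree_some] at h
    omega
  calc β = β.some.optionElim (β none) := (Finsupp.optionElim_some β).symm
    _ = β.some.optionElim (d - β.some.degree) := by rw [h']

/-- The `x₁ … xₙ`-part of an exponent of total degree `d` has total degree `≤ d`.
[cite: CoxLittleOShea2007, Ch.8 §2 Prop. 7] -/
theorem degree_some_le_of_degree_eq {β : Option σ →₀ ℕ} {d : ℕ} (h : β.degree = d) :
    β.some.degree ≤ d := by
  rw [degree_eq_none_add_degree_some] at h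
  omega

/-- `|α| ≤ deg f` for every exponent `α` occurring in `f`. [folklore] -/
private theorem degree_le_totalDegree {f : MvPolynomial σ R} {α : σ →₀ ℕ} (h : α ∈ f.support) :
    α.degree ≤ f.totalDegree := by
  rw [Finsupp.degree_apply]
  exact le_totalDegree h

/-- `deg f ≤ d` as soon as every exponent occurring in `f` has total degree `≤ d`. [folklore] -/
private theorem totalDegree_le_of_forall_degree_le {f : MvPolynomial σ R} {d : ℕ}
    (h : ∀ α ∈ f.support, α.degree ≤ d) : f.totalDegree ≤ d :=
  Finset.sup_le fun α hα => by
    have := h α hα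
    rwa [Finsupp.degree_apply] at this

/-! ## §2 Proposition 7: homogenization and dehomogenization of a polynomial -/

/-- Homogenization padded to degree `d`: `∑_α c_α · x^α x₀^{d - |α|}` (`= x₀^{d - deg f} · f^h`
when `d ≥ deg f`, see `homogenizeTo_eq_X_pow_mul`). [cite: CoxLittleOShea2007, Ch.8 §2 Prop. 7] -/
noncomputable def homogenizeTo (d : ℕ) (f : MvPolynomial σ R) : MvPolynomial (Option σ) R :=
  ∑ α ∈ f.support, monomial (α.optionElim (d - α.degree)) (coeff α f)

/-- **The homogenization** `f^h = ∑_α c_α x^α x₀^{deg f - |α|} ∈ k[x₀, x₁, …, xₙ]` of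
`f = ∑_α c_α x^α ∈ k[x₁, …, xₙ]`; the new variable `x₀` is `X none`.
[cite: CoxLittleOShea2007, Ch.8 §2 Prop. 7 (i)] -/
noncomputable def homogenization (f : MvPolynomial σ R) : MvPolynomial (Option σ) R :=
  homogenizeTo f.totalDegree f

/-- **Dehomogenization** `F ↦ F(1, x₁, …, xₙ)`: the `R`-algebra map `k[x₀, …, xₙ] → k[x₁, …, xₙ]`
setting `x₀ = 1`. [cite: CoxLittleOShea2007, Ch.8 §2 Prop. 7 (iii)] -/
noncomputable def dehomogenization : MvPolynomial (Option σ) R →ₐ[R] MvPolynomial σ R :=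
  aeval fun o => o.elim 1 X

/-- `x₀ ↦ 1`. [cite: CoxLittleOShea2007, Ch.8 §2 Prop. 7 (iii)] -/
@[simp] theorem dehomogenization_X_none :
    dehomogenization (X none : MvPolynomial (Option σ) R) = 1 := by
  simp [dehomogenization]

/-- `xᵢ ↦ xᵢ`. [cite: CoxLittleOShea2007, Ch.8 §2 Prop. 7 (iii)] -/
@[simp] theorem dehomogenization_X_some (i : σ) :
    dehomogenization (X (some i) : MvPolynomial (Option σ) R) = X i := by
  simp [dehomogenization]

/-- Constants are unchanged. [cite: CoxLittleOShea2007, Ch.8 §2 Prop. 7 (iii)] -/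
@[simp] theorem dehomogenization_C (c : R) :
    dehomogenization (C c : MvPolynomial (Option σ) R) = C c := by
  simp [dehomogenization]

/-- Dehomogenizing a monomial drops its `x₀`-exponent: `x^{β'} x₀^{β₀} ↦ x^{β'}`.
[cite: CoxLittleOShea2007, Ch.8 §2 Prop. 7 (iii)] -/
theorem dehomogenization_monomial (β : Option σ →₀ ℕ) (c : R) :
    dehomogenization (monomial β c) = monomial β.some c := by
  unfold dehomogenization
  rw [aeval_monomial, Finsupp.prod_option_index β
    (fun o n => ((o.elim 1 X : MvPolynomial σ R)) ^ n) (fun _ => pow_zero _)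
    (fun _ _ _ => pow_add _ _ _)]
  simp only [Option.elim_none, Option.elim_some, one_pow, one_mul]
  rw [monomial_eq, MvPolynomial.algebraMap_eq]

/-- The coefficient of `x^γ` in `F(1, x)` is the sum of the coefficients of `F` at the exponents
`x^γ x₀^e`, `e ≥ 0`. [cite: CoxLittleOShea2007, Ch.8 §2 Prop. 7 (iii)] -/
theorem coeff_dehomogenization [DecidableEq σ] (F : MvPolynomial (Option σ) R) (γ : σ →₀ ℕ) :
    coeff γ (dehomogenization F) =
      ∑ β ∈ F.support, if β.some = γ then coeff β F else 0 := by
  conv_lhs => rw [F.as_sum, map_sum]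
  simp_rw [dehomogenization_monomial, coeff_sum, coeff_monomial]

/-- For `F` homogeneous of degree `d` and `|γ| ≤ d`, the coefficient of `x^γ` in `F(1, x)` is the
coefficient of `x^γ x₀^{d - |γ|}` in `F`. [cite: CoxLittleOShea2007, Ch.8 §2 Prop. 7 (iv)] -/
theorem coeff_dehomogenization_of_isHomogeneous {F : MvPolynomial (Option σ) R} {d : ℕ}
    (hF : F.IsHomogeneous d) (γ : σ →₀ ℕ) :
    coeff γ (dehomogenization F) = coeff (γ.optionElim (d - γ.degree)) F := by
  classical
  rw [coeff_dehomogenization, Finset.sum_eq_single (γ.optionElim (d - γ.degree)),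
    if_pos (Finsupp.some_optionElim _ _)]
  · intro β hβ hne
    rw [ite_eq_right_iff]
    intro h
    exfalso
    apply hne
    have hd : β.degree = d := by
      by_contra hd
      exact (mem_support_iff.mp hβ) (hF.coeff_eq_zero hd)
    rw [eq_optionElim_of_degree_eq hd, h]
  · intro h
    rw [if_pos (Finsupp.some_optionElim _ _)]
    exact notMem_support_iff.mp h

/-- **A homogeneous polynomial of given degree is determined by its dehomogenization.**
[cite: CoxLittleOShea2007, Ch.8 §2 Prop. 7 (iv)] -/
theorem eq_of_dehomogenization_eq {F G : MvPolynomial (Option σ) R} {d : ℕ}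
    (hF : F.IsHomogeneous d) (hG : G.IsHomogeneous d)
    (h : dehomogenization F = dehomogenization G) : F = G := by
  ext β
  by_cases hβ : β.degree = d
  · have h1 := coeff_dehomogenization_of_isHomogeneous hF β.some
    have h2 := coeff_dehomogenization_of_isHomogeneous hG β.some
    rw [← eq_optionElim_of_degree_eq hβ] at h1 h2
    rw [← h1, ← h2, h]
  · rw [hF.coeff_eq_zero hβ, hG.coeff_eq_zero hβ]

/-- If `F` is homogeneous of degree `d` then `deg F(1, x) ≤ d`.
[cite: CoxLittleOShea2007, Ch.8 §2 Prop. 7 (iv)] -/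
theorem totalDegree_dehomogenization_le {F : MvPolynomial (Option σ) R} {d : ℕ}
    (hF : F.IsHomogeneous d) : (dehomogenization F).totalDegree ≤ d := by
  classical
  refine totalDegree_le_of_forall_degree_le fun γ hγ => ?_
  by_contra hlt
  apply mem_support_iff.mp hγ
  rw [coeff_dehomogenization]
  refine Finset.sum_eq_zero fun β hβ => ?_
  rw [ite_eq_right_iff]
  intro h
  by_contra hc
  have hd : β.degree = d := by
    by_contra hd
    exact hc (hF.coeff_eq_zero hd)
  rw [degree_eq_none_add_degree_some, h] at hd
  omega

/-- Dehomogenizing the padded homogenization gives back `f`: `(x₀^e f^h)(1, x) = f`.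
[cite: CoxLittleOShea2007, Ch.8 §2 Prop. 7 (iii)] -/
@[simp] theorem dehomogenization_homogenizeTo (d : ℕ) (f : MvPolynomial σ R) :
    dehomogenization (homogenizeTo d f) = f := by
  unfold homogenizeTo
  rw [map_sum]
  simp_rw [dehomogenization_monomial, Finsupp.some_optionElim]
  exact f.as_sum.symm

/-- The coefficients of the padded homogenization: for `d ≥ deg f`, the coefficient of `β` in
`x₀^{d - deg f} f^h` is `c_{β'}` if `|β| = d` (`β'` the `x₁ … xₙ`-part of `β`) and `0` otherwise.
[cite: CoxLittleOShea2007, Ch.8 §2 Prop. 7 (i)] -/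
theorem coeff_homogenizeTo {d : ℕ} {f : MvPolynomial σ R} (hd : f.totalDegree ≤ d)
    (β : Option σ →₀ ℕ) :
    coeff β (homogenizeTo d f) = if β.degree = d then coeff β.some f else 0 := by
  classical
  unfold homogenizeTo
  rw [coeff_sum]
  simp_rw [coeff_monomial]
  rw [Finset.sum_eq_single β.some]
  · by_cases hs : β.some ∈ f.support
    · have hle : β.some.degree ≤ d := (degree_le_totalDegree hs).trans hd
      have key : β.some.optionElim (d - β.some.degree) = β ↔ β.degree = d := by
        constructor
        · intro h
          rw [← h, degree_optionElim_eq_add]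
          omega
        · intro h
          exact (eq_optionElim_of_degree_eq h).symm
      by_cases hβ : β.degree = d
      · rw [if_pos (key.2 hβ), if_pos hβ]
      · rw [if_neg (fun h => hβ (key.1 h)), if_neg hβ]
    · rw [notMem_support_iff.mp hs]
      simp
  · intro α _ hne
    rw [ite_eq_right_iff]
    intro h
    exfalso
    apply hne
    have := congrArg Finsupp.some h
    rwa [Finsupp.some_optionElim] at this
  · intro hs
    rw [notMem_support_iff.mp hs]
    simp

/-- For `d ≥ deg f` the padded homogenization `x₀^{d - deg f} f^h` is homogeneous of degree `d`.
[cite: CoxLittleOShea2007, Ch.8 §2 Prop. 7 (i)] -/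
theorem homogenizeTo_isHomogeneous {d : ℕ} {f : MvPolynomial σ R} (hd : f.totalDegree ≤ d) :
    (homogenizeTo d f).IsHomogeneous d := by
  unfold homogenizeTo
  refine IsHomogeneous.sum _ _ _ fun α hα => isHomogeneous_monomial _ ?_
  rw [degree_optionElim_eq_add]
  have := (degree_le_totalDegree hα).trans hd
  omega

/-- **Characterisation.** A homogeneous `F` of degree `d` with `F(1, x) = f` IS the padded
homogenization `x₀^{d - deg f} f^h`. [cite: CoxLittleOShea2007, Ch.8 §2 Prop. 7 (iv)] -/
theorem eq_homogenizeTo_of_isHomogeneous {F : MvPolynomial (Option σ) R} {d : ℕ}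
    (hF : F.IsHomogeneous d) {f : MvPolynomial σ R} (h : dehomogenization F = f) :
    F = homogenizeTo d f := by
  have hd : f.totalDegree ≤ d := h ▸ totalDegree_dehomogenization_le hF
  exact eq_of_dehomogenization_eq hF (homogenizeTo_isHomogeneous hd)
    (by rw [h, dehomogenization_homogenizeTo])

/-- **§2 Prop. 7 (i): `f^h` is homogeneous of degree `deg f`.**
[cite: CoxLittleOShea2007, Ch.8 §2 Prop. 7 (i)] -/
theorem homogenization_isHomogeneous (f : MvPolynomial σ R) :
    (homogenization f).IsHomogeneous f.totalDegree :=
  homogenizeTo_isHomogeneous le_rfl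

/-- **§2 Prop. 7 (iii): dehomogenizing `f^h` gives back `f`**, `f^h (1, x₁, …, xₙ) = f`.
[cite: CoxLittleOShea2007, Ch.8 §2 Prop. 7 (iii)] -/
@[simp] theorem dehomogenization_homogenization (f : MvPolynomial σ R) :
    dehomogenization (homogenization f) = f :=
  dehomogenization_homogenizeTo _ f

/-- Homogenization is injective. [cite: CoxLittleOShea2007, Ch.8 §2 Prop. 7 (iii)] -/
theorem homogenization_injective :
    Function.Injective (homogenization : MvPolynomial σ R → MvPolynomial (Option σ) R) :=
  fun f g h => by
    rw [← dehomogenization_homogenization f, h, dehomogenization_homogenization]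

/-- `f^h = 0 ↔ f = 0`. [cite: CoxLittleOShea2007, Ch.8 §2 Prop. 7 (iii)] -/
@[simp] theorem homogenization_eq_zero_iff {f : MvPolynomial σ R} :
    homogenization f = 0 ↔ f = 0 := by
  constructor
  · intro h
    rw [← dehomogenization_homogenization f, h, map_zero]
  · rintro rfl
    simp [homogenization, homogenizeTo]

/-- `0^h = 0`. [cite: CoxLittleOShea2007, Ch.8 §2 Prop. 7 (i)] -/
@[simp] theorem homogenization_zero : homogenization (0 : MvPolynomial σ R) = 0 :=
  homogenization_eq_zero_iff.2 rfl

/-- **§2 Prop. 7 (i): `deg f^h = deg f`.** [cite: CoxLittleOShea2007, Ch.8 §2 Prop. 7 (i)] -/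
theorem totalDegree_homogenization (f : MvPolynomial σ R) :
    (homogenization f).totalDegree = f.totalDegree := by
  by_cases hf : f = 0
  · simp [hf]
  · exact (homogenization_isHomogeneous f).totalDegree fun h =>
      hf (homogenization_eq_zero_iff.1 h)

/-- The coefficients of `f^h`: `c_{β'}` at the exponents `β` of total degree `deg f`, `0` elsewhere.
[cite: CoxLittleOShea2007, Ch.8 §2 Prop. 7 (i)] -/
theorem coeff_homogenization (f : MvPolynomial σ R) (β : Option σ →₀ ℕ) :
    coeff β (homogenization f) = if β.degree = f.totalDegree then coeff β.some f else 0 :=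
  coeff_homogenizeTo le_rfl β

/-- A homogeneous polynomial is its own homogenization up to renaming `xᵢ ↦ xᵢ` (no `x₀` appears):
the coefficient of `x^α x₀^0` in `f^h` is `c_α` when `|α| = deg f`.
[cite: CoxLittleOShea2007, Ch.8 §2 Prop. 7 (i)] -/
theorem coeff_optionElim_zero_homogenization (f : MvPolynomial σ R) {α : σ →₀ ℕ}
    (hα : α.degree = f.totalDegree) :
    coeff (α.optionElim 0) (homogenization f) = coeff α f := by
  rw [coeff_homogenization, degree_optionElim_eq_add, zero_add, if_pos hα, Finsupp.some_optionElim]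

/-- Constants: `(c)^h = c`. [cite: CoxLittleOShea2007, Ch.8 §2 Prop. 7 (i)] -/
@[simp] theorem homogenization_C (c : R) :
    homogenization (C c : MvPolynomial σ R) = C c := by
  have h := eq_homogenizeTo_of_isHomogeneous (isHomogeneous_C (Option σ) c) (f := C c)
    (by rw [dehomogenization_C])
  rw [homogenization, totalDegree_C]
  exact h.symm

/-- `1^h = 1`. [cite: CoxLittleOShea2007, Ch.8 §2 Prop. 7 (i)] -/
@[simp] theorem homogenization_one : homogenization (1 : MvPolynomial σ R) = 1 := by
  rw [← C_1, homogenization_C, C_1]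

/-- Variables: `(xᵢ)^h = xᵢ` (over a nontrivial ring, where `deg xᵢ = 1`).
[cite: CoxLittleOShea2007, Ch.8 §2 Prop. 7 (i)] -/
@[simp] theorem homogenization_X [Nontrivial R] (i : σ) :
    homogenization (X i : MvPolynomial σ R) = X (some i) := by
  have h := eq_homogenizeTo_of_isHomogeneous (isHomogeneous_X R (some i : Option σ)) (f := X i)
    (by rw [dehomogenization_X_some])
  rw [homogenization, totalDegree_X]
  exact h.symm

/-- For `d ≥ deg f`: `homogenizeTo d f = x₀^{d - deg f} · f^h`.
[cite: CoxLittleOShea2007, Ch.8 §2 Prop. 7 (iv)] -/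
theorem homogenizeTo_eq_X_pow_mul {d : ℕ} {f : MvPolynomial σ R} (hd : f.totalDegree ≤ d) :
    homogenizeTo d f = X none ^ (d - f.totalDegree) * homogenization f := by
  symm
  refine eq_homogenizeTo_of_isHomogeneous ?_ ?_
  · have := ((isHomogeneous_X R (none : Option σ)).pow (d - f.totalDegree)).mul
      (homogenization_isHomogeneous f)
    rwa [one_mul, Nat.sub_add_cancel hd] at this
  · rw [map_mul, map_pow, dehomogenization_X_none, one_pow, one_mul,
      dehomogenization_homogenization]

/-- `homogenizeTo (deg f) f = f^h`. [cite: CoxLittleOShea2007, Ch.8 §2 Prop. 7 (i)] -/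
theorem homogenizeTo_totalDegree (f : MvPolynomial σ R) :
    homogenizeTo f.totalDegree f = homogenization f := rfl

/-- **§2 Prop. 7 (iv): a homogeneous `F` of degree `d` is `x₀^{d - deg f} · f^h` where
`f = F(1, x₁, …, xₙ)` is its dehomogenization.** [cite: CoxLittleOShea2007, Ch.8 §2 Prop. 7 (iv)] -/
theorem eq_X_pow_mul_homogenization_of_isHomogeneous {F : MvPolynomial (Option σ) R} {d : ℕ}
    (hF : F.IsHomogeneous d) :
    F = X none ^ (d - (dehomogenization F).totalDegree) *
      homogenization (dehomogenization F) := by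
  rw [← homogenizeTo_eq_X_pow_mul (totalDegree_dehomogenization_le hF)]
  exact eq_homogenizeTo_of_isHomogeneous hF rfl

/-- In particular a homogeneous `F` is divisible by the homogenization of its dehomogenization.
[cite: CoxLittleOShea2007, Ch.8 §2 Prop. 7 (iv)] -/
theorem homogenization_dehomogenization_dvd_of_isHomogeneous {F : MvPolynomial (Option σ) R}
    {d : ℕ} (hF : F.IsHomogeneous d) : homogenization (dehomogenization F) ∣ F :=
  ⟨X none ^ (d - (dehomogenization F).totalDegree), by
    rw [mul_comm]; exact eq_X_pow_mul_homogenization_of_isHomogeneous hF⟩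

/-! ### Additivity and multiplicativity (via the characterisation) -/

/-- Padding further: `homogenizeTo (d + e) f = x₀^e · homogenizeTo d f` for `d ≥ deg f`.
[cite: CoxLittleOShea2007, Ch.8 §2 Prop. 7 (iv)] -/
theorem homogenizeTo_add_right {d : ℕ} {f : MvPolynomial σ R} (hd : f.totalDegree ≤ d) (e : ℕ) :
    homogenizeTo (d + e) f = X none ^ e * homogenizeTo d f := by
  rw [homogenizeTo_eq_X_pow_mul hd, homogenizeTo_eq_X_pow_mul (hd.trans (Nat.le_add_right d e)),
    ← mul_assoc, ← pow_add]
  congr 2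
  omega

/-- **Additivity**: for `d ≥ deg f, deg g`, `homogenizeTo d (f + g) = homogenizeTo d f +
homogenizeTo d g`, i.e. `x₀^{d - deg(f+g)} (f + g)^h = x₀^{d - deg f} f^h + x₀^{d - deg g} g^h`.
[cite: CoxLittleOShea2007, Ch.8 §2 Prop. 7 (i)] -/
theorem homogenizeTo_add {d : ℕ} {f g : MvPolynomial σ R} (hf : f.totalDegree ≤ d)
    (hg : g.totalDegree ≤ d) :
    homogenizeTo d (f + g) = homogenizeTo d f + homogenizeTo d g := by
  symm
  refine eq_homogenizeTo_of_isHomogeneous ?_ ?_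
  · exact (homogenizeTo_isHomogeneous hf).add (homogenizeTo_isHomogeneous hg)
  · rw [map_add, dehomogenization_homogenizeTo, dehomogenization_homogenizeTo]

/-- **Additivity over finite sums**: if every `deg pᵢ ≤ d` then
`homogenizeTo d (∑ pᵢ) = ∑ homogenizeTo d pᵢ`. [cite: CoxLittleOShea2007, Ch.8 §2 Prop. 7 (i)] -/
theorem homogenizeTo_sum {ι : Type*} (s : Finset ι) {p : ι → MvPolynomial σ R} {d : ℕ}
    (h : ∀ i ∈ s, (p i).totalDegree ≤ d) :
    homogenizeTo d (∑ i ∈ s, p i) = ∑ i ∈ s, homogenizeTo d (p i) := by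
  symm
  refine eq_homogenizeTo_of_isHomogeneous ?_ ?_
  · exact IsHomogeneous.sum s _ d fun i hi => homogenizeTo_isHomogeneous (h i hi)
  · rw [map_sum]
    exact Finset.sum_congr rfl fun i _ => dehomogenization_homogenizeTo d (p i)

/-- **Multiplicativity**: for `d ≥ deg f`, `e ≥ deg g`,
`homogenizeTo (d + e) (f g) = homogenizeTo d f · homogenizeTo e g`.
[cite: CoxLittleOShea2007, Ch.8 §2 Prop. 7 (ii)] -/
theorem homogenizeTo_mul {d e : ℕ} {f g : MvPolynomial σ R} (hf : f.totalDegree ≤ d)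
    (hg : g.totalDegree ≤ e) :
    homogenizeTo (d + e) (f * g) = homogenizeTo d f * homogenizeTo e g := by
  symm
  refine eq_homogenizeTo_of_isHomogeneous ?_ ?_
  · exact (homogenizeTo_isHomogeneous hf).mul (homogenizeTo_isHomogeneous hg)
  · rw [map_mul, dehomogenization_homogenizeTo, dehomogenization_homogenizeTo]

/-- `f^h · g^h = x₀^{deg f + deg g - deg (fg)} · (f g)^h` in general.
[cite: CoxLittleOShea2007, Ch.8 §2 Prop. 7 (ii)] -/
theorem homogenization_mul_homogenization (f g : MvPolynomial σ R) :
    homogenization f * homogenization g =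
      X none ^ (f.totalDegree + g.totalDegree - (f * g).totalDegree) * homogenization (f * g) := by
  rw [← homogenizeTo_totalDegree f, ← homogenizeTo_totalDegree g,
    ← homogenizeTo_mul le_rfl le_rfl, homogenizeTo_eq_X_pow_mul (totalDegree_mul f g)]

/-- **`(f g)^h = f^h g^h` over a domain** (where `deg (fg) = deg f + deg g`).
[cite: CoxLittleOShea2007, Ch.8 §2 Prop. 7 (ii)] -/
theorem homogenization_mul [NoZeroDivisors R] (f g : MvPolynomial σ R) :
    homogenization (f * g) = homogenization f * homogenization g := by
  by_cases hf : f = 0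
  · simp [hf]
  by_cases hg : g = 0
  · simp [hg]
  rw [homogenization_mul_homogenization, totalDegree_mul_of_isDomain hf hg, Nat.sub_self, pow_zero,
    one_mul]

/-! ### At infinity: `f^h (0, x)` is the top homogeneous component of `f` -/

/-- Setting `x₀ = 0` in `f^h` leaves the homogeneous component of `f` of top degree `deg f`
(the part of `V(f^h)` at infinity is cut out by the leading form).
[cite: CoxLittleOShea2007, Ch.8 §2 Prop. 7 (i)] -/
theorem aeval_zero_homogenization (f : MvPolynomial σ R) :
    aeval (fun o : Option σ => (o.elim 0 X : MvPolynomial σ R)) (homogenization f) =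
      homogeneousComponent f.totalDegree f := by
  classical
  rw [homogenization, homogenizeTo, map_sum, homogeneousComponent_apply]
  rw [Finset.sum_filter]
  refine Finset.sum_congr rfl fun α hα => ?_
  rw [aeval_monomial, Finsupp.prod_option_index _
    (fun o n => ((o.elim 0 X : MvPolynomial σ R)) ^ n) (fun _ => pow_zero _)
    (fun _ _ _ => pow_add _ _ _)]
  simp only [Option.elim_none, Option.elim_some, Finsupp.optionElim_apply_none,
    Finsupp.some_optionElim, MvPolynomial.algebraMap_eq]
  by_cases h : α.degree = f.totalDegree
  · rw [if_pos h, h, Nat.sub_self, pow_zero, one_mul, monomial_eq]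
  · have hlt : 0 < f.totalDegree - α.degree := by
      have := degree_le_totalDegree hα
      omega
    rw [if_neg h, zero_pow hlt.ne', zero_mul, mul_zero]

end CommSemiring

/-! ## §4 Definition 1, Proposition 2: the homogenization `I^h` of an ideal -/

section Ideal

variable {σ : Type*} {R : Type*} [CommRing R]

/-- **§4 Definition 1: the homogenization `I^h = ⟨f^h : f ∈ I⟩ ⊆ k[x₀, …, xₙ]`** of an ideal
`I ⊆ k[x₁, …, xₙ]`. [cite: CoxLittleOShea2007, Ch.8 §4 Def. 1] -/
noncomputable def idealHomogenization (I : Ideal (MvPolynomial σ R)) :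
    Ideal (MvPolynomial (Option σ) R) :=
  Ideal.span (homogenization '' (I : Set (MvPolynomial σ R)))

/-- `f ∈ I → f^h ∈ I^h`. [cite: CoxLittleOShea2007, Ch.8 §4 Def. 1] -/
theorem homogenization_mem_idealHomogenization {I : Ideal (MvPolynomial σ R)}
    {f : MvPolynomial σ R} (hf : f ∈ I) : homogenization f ∈ idealHomogenization I :=
  Ideal.subset_span ⟨f, hf, rfl⟩

/-- `I^h` is monotone in `I`. [cite: CoxLittleOShea2007, Ch.8 §4 Def. 1] -/
theorem idealHomogenization_mono {I J : Ideal (MvPolynomial σ R)} (h : I ≤ J) :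
    idealHomogenization I ≤ idealHomogenization J :=
  Ideal.span_mono (Set.image_mono h)

-- Mathlib ships the grading of `MvPolynomial` by total degree as the non-instance abbrev
-- `MvPolynomial.gradedAlgebra`; it is made a local instance here exactly as in the tree's
-- `HilbertPolynomialExists.lean` / `EquidimensionalHilbert.lean`, only to SPELL
-- `Ideal.IsHomogeneous`.
attribute [local instance] MvPolynomial.gradedAlgebra

/-- **§4 Proposition 2: `I^h` is a homogeneous ideal** (it is generated by homogeneous
polynomials). [cite: CoxLittleOShea2007, Ch.8 §4 Prop. 2] -/
theorem isHomogeneous_idealHomogenization (I : Ideal (MvPolynomial σ R)) :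
    (idealHomogenization I).IsHomogeneous (homogeneousSubmodule (Option σ) R) :=
  Ideal.homogeneous_span _ _ fun F hF => by
    obtain ⟨f, -, rfl⟩ := hF
    exact ⟨f.totalDegree, homogenization_isHomogeneous f⟩

/-- Prop. 2 in elementary terms (Ch. 8 §3 Thm. 2): every homogeneous component of a member of
`I^h` lies in `I^h`. [cite: CoxLittleOShea2007, Ch.8 §4 Prop. 2; Ch.8 §3 Thm. 2] -/
theorem homogeneousComponent_mem_idealHomogenization {I : Ideal (MvPolynomial σ R)}
    {F : MvPolynomial (Option σ) R} (hF : F ∈ idealHomogenization I) (n : ℕ) :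
    homogeneousComponent n F ∈ idealHomogenization I := by
  have h := (isHomogeneous_idealHomogenization I) n hF
  rwa [show (DirectSum.decompose (homogeneousSubmodule (Option σ) R) F n :
      MvPolynomial (Option σ) R) = homogeneousComponent n F from
      MvPolynomial.decomposition.decompose'_apply F n] at h

/-- **Dehomogenizing `I^h` gives back `I`**: `{F(1, x) : F ∈ I^h} = I` (as ideals: the image of
`I^h` under `x₀ ↦ 1` is `I`). [cite: CoxLittleOShea2007, Ch.8 §4 Prop. 7 (i) (proof)] -/
theorem map_dehomogenization_idealHomogenization (I : Ideal (MvPolynomial σ R)) :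
    (idealHomogenization I).map (dehomogenization : MvPolynomial (Option σ) R →ₐ[R] _) = I := by
  rw [idealHomogenization, Ideal.map_span, ← Set.image_comp]
  have : ((dehomogenization : MvPolynomial (Option σ) R →ₐ[R] MvPolynomial σ R) ∘
      homogenization) = id := funext dehomogenization_homogenization
  rw [this, Set.image_id, Ideal.span_eq]

/-- `F ∈ I^h → F(1, x) ∈ I`. [cite: CoxLittleOShea2007, Ch.8 §4 Prop. 7 (i) (proof)] -/
theorem dehomogenization_mem {I : Ideal (MvPolynomial σ R)} {F : MvPolynomial (Option σ) R}
    (hF : F ∈ idealHomogenization I) : dehomogenization F ∈ I := by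
  have h := Ideal.mem_map_of_mem (dehomogenization : MvPolynomial (Option σ) R →ₐ[R] _) hF
  rwa [map_dehomogenization_idealHomogenization] at h

/-- **Membership of a HOMOGENEOUS polynomial in `I^h`**: `F ∈ I^h ↔ F(1, x) ∈ I` (the converse
direction is `F = x₀^e · (F(1,x))^h`, §2 Prop. 7 (iv)).
[cite: CoxLittleOShea2007, Ch.8 §4 Thm. 8 (proof)] -/
theorem mem_idealHomogenization_iff {I : Ideal (MvPolynomial σ R)} {F : MvPolynomial (Option σ) R}
    {d : ℕ} (hF : F.IsHomogeneous d) :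
    F ∈ idealHomogenization I ↔ dehomogenization F ∈ I := by
  refine ⟨dehomogenization_mem, fun h => ?_⟩
  rw [eq_X_pow_mul_homogenization_of_isHomogeneous hF]
  exact Ideal.mul_mem_left _ _ (homogenization_mem_idealHomogenization h)

/-- `f^h ∈ I^h ↔ f ∈ I`. [cite: CoxLittleOShea2007, Ch.8 §4 Def. 1] -/
@[simp] theorem homogenization_mem_idealHomogenization_iff {I : Ideal (MvPolynomial σ R)}
    {f : MvPolynomial σ R} : homogenization f ∈ idealHomogenization I ↔ f ∈ I := by
  rw [mem_idealHomogenization_iff (homogenization_isHomogeneous f),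
    dehomogenization_homogenization]

/-- `I^h = ⊤ ↔ I = ⊤`. [cite: CoxLittleOShea2007, Ch.8 §4 Def. 1] -/
theorem idealHomogenization_eq_top_iff {I : Ideal (MvPolynomial σ R)} :
    idealHomogenization I = ⊤ ↔ I = ⊤ := by
  rw [Ideal.eq_top_iff_one, Ideal.eq_top_iff_one, ← homogenization_one,
    homogenization_mem_idealHomogenization_iff]

/-- `(⊥)^h = ⊥`. [cite: CoxLittleOShea2007, Ch.8 §4 Def. 1] -/
@[simp] theorem idealHomogenization_bot :
    idealHomogenization (⊥ : Ideal (MvPolynomial σ R)) = ⊥ := by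
  rw [idealHomogenization, Ideal.span_eq_bot]
  rintro _ ⟨f, hf, rfl⟩
  rw [SetLike.mem_coe, Ideal.mem_bot] at hf
  rw [hf, homogenization_zero]

/-- `(⊤)^h = ⊤`. [cite: CoxLittleOShea2007, Ch.8 §4 Def. 1] -/
@[simp] theorem idealHomogenization_top :
    idealHomogenization (⊤ : Ideal (MvPolynomial σ R)) = ⊤ :=
  idealHomogenization_eq_top_iff.2 rfl

/-- Homogenizing a generating set gives an ideal CONTAINED in `I^h` (in general strictly, see
Example 3). [cite: CoxLittleOShea2007, Ch.8 §4 Example 3] -/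
theorem span_image_homogenization_le {S : Set (MvPolynomial σ R)} :
    Ideal.span (homogenization '' S) ≤ idealHomogenization (Ideal.span S) :=
  Ideal.span_mono (Set.image_mono Ideal.subset_span)

/-- **Hypersurfaces: `⟨f⟩^h = ⟨f^h⟩` over a domain** (`(a f)^h = a^h f^h`).
[cite: CoxLittleOShea2007, Ch.8 §2 Prop. 7 (ii); Ch.8 §4 Def. 1] -/
theorem idealHomogenization_span_singleton [NoZeroDivisors R] (f : MvPolynomial σ R) :
    idealHomogenization (Ideal.span {f}) = Ideal.span {homogenization f} := by
  apply le_antisymm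
  · rw [idealHomogenization, Ideal.span_le]
    rintro _ ⟨g, hg, rfl⟩
    rw [SetLike.mem_coe, Ideal.mem_span_singleton'] at hg
    obtain ⟨a, rfl⟩ := hg
    rw [SetLike.mem_coe, homogenization_mul]
    exact Ideal.mul_mem_left _ _ (Ideal.mem_span_singleton_self _)
  · have : ({homogenization f} : Set (MvPolynomial (Option σ) R)) = homogenization '' {f} := by
      rw [Set.image_singleton]
    rw [this]
    exact span_image_homogenization_le

/-! ### §4 Proposition 7 (i) in the chart `x₀ = 1`: the affine part of `V(I^h)` is `V(I)` -/

/-- Evaluating at the affine point `(1 : a)` is evaluating the dehomogenization at `a`.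
[cite: CoxLittleOShea2007, Ch.8 §4 Prop. 7 (i)] -/
theorem eval_one_elim (a : σ → R) (F : MvPolynomial (Option σ) R) :
    eval (fun o : Option σ => o.elim 1 a) F = eval a (dehomogenization F) := by
  induction F using MvPolynomial.induction_on with
  | C c => simp
  | add p q hp hq => simp [hp, hq]
  | mul_X p o hp => cases o <;> simp [hp]

/-- **§4 Prop. 7 (i): `V(I^h) ∩ U₀ = V(I)`** — a point `(1 : a₁ : ⋯ : aₙ)` of the affine chart
`x₀ ≠ 0` is a zero of every `F ∈ I^h` iff `a` is a zero of every `f ∈ I`.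
[cite: CoxLittleOShea2007, Ch.8 §4 Prop. 7 (i)] -/
theorem forall_eval_one_eq_zero_iff (I : Ideal (MvPolynomial σ R)) (a : σ → R) :
    (∀ F ∈ idealHomogenization I, eval (fun o : Option σ => o.elim 1 a) F = 0) ↔
      ∀ f ∈ I, eval a f = 0 := by
  constructor
  · intro h f hf
    have := h _ (homogenization_mem_idealHomogenization hf)
    rwa [eval_one_elim, dehomogenization_homogenization] at this
  · intro h F hF
    rw [eval_one_elim]
    exact h _ (dehomogenization_mem hF)

/-! ### §4 Example 3: homogenized generators need not generate `I^h` (affine twisted cubic) -/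

section TwistedCubic

variable (R)

/-- The ideal `I = ⟨x₂ - x₁², x₃ - x₁³⟩` of the affine twisted cubic (variables `x₁, x₂, x₃` are
`X 0, X 1, X 2`). [cite: CoxLittleOShea2007, Ch.8 §4 Example 3] -/
noncomputable def twistedCubicIdeal : Ideal (MvPolynomial (Fin 3) R) :=
  Ideal.span {X 1 - X 0 ^ 2, X 2 - X 0 ^ 3}

/-- `J = ⟨x₂x₀ - x₁², x₃x₀² - x₁³⟩`, the ideal generated by the homogenized generators.
[cite: CoxLittleOShea2007, Ch.8 §4 Example 3] -/
noncomputable def twistedCubicHomogenizedSpan : Ideal (MvPolynomial (Option (Fin 3)) R) :=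
  Ideal.span {X (some 1) * X none - X (some 0) ^ 2, X (some 2) * X none ^ 2 - X (some 0) ^ 3}

variable {R}

/-- `x₂x₀ - x₁²` is homogeneous of degree 2. [cite: CoxLittleOShea2007, Ch.8 §4 Example 3] -/
private theorem isHomogeneous_gen₁ :
    (X (some 1) * X none - X (some 0) ^ 2 : MvPolynomial (Option (Fin 3)) R).IsHomogeneous 2 :=
  ((isHomogeneous_X R _).mul (isHomogeneous_X R _)).sub ((isHomogeneous_X R _).pow 2)

/-- `x₃x₀² - x₁³` is homogeneous of degree 3. [cite: CoxLittleOShea2007, Ch.8 §4 Example 3] -/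
private theorem isHomogeneous_gen₂ :
    (X (some 2) * X none ^ 2 - X (some 0) ^ 3 : MvPolynomial (Option (Fin 3)) R).IsHomogeneous 3 :=
  ((isHomogeneous_X R _).mul ((isHomogeneous_X R _).pow 2)).sub ((isHomogeneous_X R _).pow 3)

/-- `x₀x₃ - x₁x₂` is homogeneous of degree 2. [cite: CoxLittleOShea2007, Ch.8 §4 Example 3] -/
private theorem isHomogeneous_f₃h :
    (X none * X (some 2) - X (some 0) * X (some 1) : MvPolynomial (Option (Fin 3)) R).IsHomogeneous
      2 :=
  ((isHomogeneous_X R _).mul (isHomogeneous_X R _)).sub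
    ((isHomogeneous_X R _).mul (isHomogeneous_X R _))

/-- `J ⊆ I^h`: the homogenized generators are homogeneous with dehomogenizations in `I`.
[cite: CoxLittleOShea2007, Ch.8 §4 Example 3] -/
theorem twistedCubicHomogenizedSpan_le :
    twistedCubicHomogenizedSpan R ≤ idealHomogenization (twistedCubicIdeal R) := by
  rw [twistedCubicHomogenizedSpan, Ideal.span_le]
  rintro F hF
  simp only [Set.mem_insert_iff, Set.mem_singleton_iff] at hF
  rcases hF with rfl | rfl
  · rw [SetLike.mem_coe, mem_idealHomogenization_iff isHomogeneous_gen₁]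
    simp only [map_sub, map_mul, map_pow, dehomogenization_X_some, dehomogenization_X_none,
      mul_one]
    exact Ideal.subset_span (by simp)
  · rw [SetLike.mem_coe, mem_idealHomogenization_iff isHomogeneous_gen₂]
    simp only [map_sub, map_mul, map_pow, dehomogenization_X_some, dehomogenization_X_none,
      one_pow, mul_one]
    exact Ideal.subset_span (by simp)

/-- `f₃ = x₃ - x₁x₂ = f₂ - x₁ f₁ ∈ I`, so `f₃^h = x₀x₃ - x₁x₂ ∈ I^h`.
[cite: CoxLittleOShea2007, Ch.8 §4 Example 3] -/
theorem f₃h_mem_idealHomogenization :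
    (X none * X (some 2) - X (some 0) * X (some 1) : MvPolynomial (Option (Fin 3)) R) ∈
      idealHomogenization (twistedCubicIdeal R) := by
  rw [mem_idealHomogenization_iff isHomogeneous_f₃h]
  simp only [map_sub, map_mul, dehomogenization_X_some, dehomogenization_X_none, one_mul]
  rw [twistedCubicIdeal, Ideal.mem_span_pair]
  exact ⟨-X 0, 1, by ring⟩

open DualNumber in
/-- The probe `x₀ ↦ ε, x₁ ↦ 0, x₂ ↦ ε, x₃ ↦ 1` into the dual numbers `R[ε]` (`ε² = 0`): it kills
both homogenized generators but not `x₀x₃ - x₁x₂`. [cite: CoxLittleOShea2007, Ch.8 §4 Example 3] -/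
private noncomputable def probe : MvPolynomial (Option (Fin 3)) R →ₐ[R] R[ε] :=
  aeval fun o : Option (Fin 3) => o.elim ε ![0, ε, 1]

open DualNumber in
/-- The probe kills `J`. [cite: CoxLittleOShea2007, Ch.8 §4 Example 3] -/
private theorem probe_eq_zero {F : MvPolynomial (Option (Fin 3)) R}
    (hF : F ∈ twistedCubicHomogenizedSpan R) : probe F = 0 := by
  rw [twistedCubicHomogenizedSpan, Ideal.mem_span_pair] at hF
  obtain ⟨a, b, rfl⟩ := hF
  have h1 : probe (X (some 1) * X none - X (some 0) ^ 2 : MvPolynomial (Option (Fin 3)) R) = 0 := by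
    simp [probe, eps_mul_eps]
  have h2 : probe (X (some 2) * X none ^ 2 - X (some 0) ^ 3 : MvPolynomial (Option (Fin 3)) R)
      = 0 := by
    simp [probe, eps_pow_two]
  rw [map_add, map_mul, map_mul, h1, h2, mul_zero, mul_zero, add_zero]

open DualNumber in
/-- The probe sends `x₀x₃ - x₁x₂` to `ε ≠ 0`. [cite: CoxLittleOShea2007, Ch.8 §4 Example 3] -/
private theorem probe_f₃h :
    probe (X none * X (some 2) - X (some 0) * X (some 1) : MvPolynomial (Option (Fin 3)) R) =
      ε := by
  simp [probe]

/-- **`f₃^h = x₀x₃ - x₁x₂ ∉ J`** (over a nontrivial ring).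
[cite: CoxLittleOShea2007, Ch.8 §4 Example 3] -/
theorem f₃h_not_mem_twistedCubicHomogenizedSpan [Nontrivial R] :
    (X none * X (some 2) - X (some 0) * X (some 1) : MvPolynomial (Option (Fin 3)) R) ∉
      twistedCubicHomogenizedSpan R := by
  intro h
  have h0 := probe_eq_zero h
  rw [probe_f₃h] at h0
  have := congrArg TrivSqZeroExt.snd h0
  rw [DualNumber.snd_eps, TrivSqZeroExt.snd_zero] at this
  exact one_ne_zero this

/-- **§4 Example 3: `J = ⟨f₁^h, f₂^h⟩ ⊊ I^h`** for the affine twisted cubic — homogenizing a set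
of generators of `I` need not generate `I^h` (over any nontrivial commutative ring, e.g. `ℝ`).
[cite: CoxLittleOShea2007, Ch.8 §4 Example 3] -/
theorem twistedCubicHomogenizedSpan_lt [Nontrivial R] :
    twistedCubicHomogenizedSpan R < idealHomogenization (twistedCubicIdeal R) :=
  lt_of_le_of_ne twistedCubicHomogenizedSpan_le fun h =>
    f₃h_not_mem_twistedCubicHomogenizedSpan (h ▸ f₃h_mem_idealHomogenization)

end TwistedCubic

end Ideal

/-! ## §4 Theorem 4: for a graded order, a Gröbner basis of `I` homogenizes to a basis of `I^h` -/

section Groebner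

variable {σ : Type*} {k : Type*} [Field k]

/-- A monomial order is **graded** if it refines the total degree: `a ≼ b → |a| ≤ |b|`, i.e.
`x^α > x^β` whenever `|α| > |β|` (`isGradedOrder_iff`); grlex and grevlex are graded, lex is not.
[cite: CoxLittleOShea2007, Ch.8 §4 Thm. 4] -/
def IsGradedOrder (m : MonomialOrder σ) : Prop :=
  ∀ ⦃a b : σ →₀ ℕ⦄, a ≼[m] b → a.degree ≤ b.degree

/-- The book's phrasing: `|α| > |β| → x^α > x^β`. [cite: CoxLittleOShea2007, Ch.8 §4 Thm. 4] -/
theorem isGradedOrder_iff {m : MonomialOrder σ} :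
    IsGradedOrder m ↔ ∀ ⦃a b : σ →₀ ℕ⦄, a.degree < b.degree → a ≺[m] b := by
  constructor
  · intro h a b hab
    by_contra hba
    exact absurd (h (not_lt.mp hba)) (not_le.mpr hab)
  · intro h a b hab
    by_contra hlt
    exact absurd hab (not_le.mpr (h (not_le.mp hlt)))

/-- The graded lexicographic order is graded.
[cite: CoxLittleOShea2007, Ch.8 §4 Thm. 4; Ch.2 §2 Def. 5] -/
theorem isGradedOrder_degLex [LinearOrder σ] [WellFoundedGT σ] :
    IsGradedOrder (MonomialOrder.degLex : MonomialOrder σ) := by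
  intro a b h
  rw [MonomialOrder.degLex_le_iff, Finsupp.DegLex.le_iff] at h
  rcases h with h | ⟨h, -⟩
  · exact le_of_lt h
  · exact le_of_eq h

/-- **For a graded order the leading monomial has maximal total degree**: `|multideg f| = deg f`
(the point of Lemma 5). [cite: CoxLittleOShea2007, Ch.8 §4 Lemma 5] -/
theorem IsGradedOrder.degree_degree {m : MonomialOrder σ} (hm : IsGradedOrder m)
    {f : MvPolynomial σ k} (hf : f ≠ 0) : (m.degree f).degree = f.totalDegree := by
  apply le_antisymm
  · exact degree_le_totalDegree ((m.degree_mem_support_iff f).2 hf)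
  · exact totalDegree_le_of_forall_degree_le fun α hα => hm (m.le_degree hα)

/-- For a graded order, `multideg g ≼ multideg f` forces `deg g ≤ deg f`.
[cite: CoxLittleOShea2007, Ch.8 §4 Thm. 4 (proof)] -/
theorem IsGradedOrder.totalDegree_le_of_degree_le {m : MonomialOrder σ} (hm : IsGradedOrder m)
    {f g : MvPolynomial σ k} (hf : f ≠ 0) (h : m.degree g ≼[m] m.degree f) :
    g.totalDegree ≤ f.totalDegree := by
  by_cases hg : g = 0
  · rw [hg, totalDegree_zero]
    exact Nat.zero_le _
  · rw [← hm.degree_degree hg, ← hm.degree_degree hf]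
    exact hm h

/-- **§4 Theorem 4.** If `G` is a Gröbner basis of `I ⊆ k[x₁, …, xₙ]` for a GRADED monomial order,
then the homogenizations `G^h = {g^h : g ∈ G}` generate `I^h`: `I^h = ⟨G^h⟩`. (Proof: divide
`f ∈ I` by `G`, `f = ∑ q_g g` with `multideg (q_g g) ≼ multideg f`, hence — the order being
graded — `deg (q_g g) ≤ deg f`, so `f^h = ∑ x₀^{deg f - deg (q_g g)} q_g^h g^h ∈ ⟨G^h⟩`.)
[cite: CoxLittleOShea2007, Ch.8 §4 Thm. 4] -/
theorem idealHomogenization_eq_span_of_isGroebnerBasis {m : MonomialOrder σ}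
    (hm : IsGradedOrder m) {G : Set (MvPolynomial σ k)} {I : Ideal (MvPolynomial σ k)}
    (hG : IsGroebnerBasis m G I) :
    idealHomogenization I = Ideal.span (homogenization '' G) := by
  classical
  refine le_antisymm ?_ (Ideal.span_mono (Set.image_mono hG.1))
  rw [idealHomogenization, Ideal.span_le]
  rintro _ ⟨f, hf, rfl⟩
  rw [SetLike.mem_coe] at hf ⊢
  by_cases hf0 : f = 0
  · rw [hf0, homogenization_zero]
    exact Ideal.zero_mem _
  -- divide `f` by the non-zero members of `G`
  have hBu : ∀ b ∈ G \ {0}, IsUnit (m.leadingCoeff b) := fun b hb =>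
    isUnit_iff_ne_zero.2 (m.leadingCoeff_ne_zero_iff.2 hb.2)
  obtain ⟨q, r, hfqr, hdeg, hr⟩ := m.div_set hBu f
  have hsumI : Finsupp.linearCombination (MvPolynomial σ k)
      (fun b : ↥(G \ {0}) => (b : MvPolynomial σ k)) q ∈ I := by
    rw [Finsupp.linearCombination_apply, Finsupp.sum]
    exact Ideal.sum_mem _ fun b _ => by
      rw [smul_eq_mul]
      exact Ideal.mul_mem_left _ _ (hG.1 b.2.1)
  -- the remainder lies in `I` and no leading term of `G` divides any of its monomials: it is `0`
  have hrI : r ∈ I := by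
    have : r = f - Finsupp.linearCombination (MvPolynomial σ k)
        (fun b : ↥(G \ {0}) => (b : MvPolynomial σ k)) q := by
      rw [hfqr]; ring
    rw [this]
    exact I.sub_mem hf hsumI
  have hr0 : r = 0 := by
    by_contra hr0
    obtain ⟨g, hgG, hg0, hle⟩ := ((isGroebnerBasis_iff (m := m)).1 hG).2 r hrI hr0
    exact hr _ ((m.degree_mem_support_iff r).2 hr0) g ⟨hgG, hg0⟩ hle
  rw [hr0, add_zero] at hfqr
  -- `f = ∑ q_b b` with `deg (q_b b) ≤ deg f`
  have hf' : f = ∑ b ∈ q.support, q b * (b : MvPolynomial σ k) := by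
    rw [hfqr, Finsupp.linearCombination_apply, Finsupp.sum]
    simp only [smul_eq_mul]
  have hdeg' : ∀ b ∈ q.support, (q b * (b : MvPolynomial σ k)).totalDegree ≤ f.totalDegree :=
    fun b _ => by
      rw [mul_comm]
      exact hm.totalDegree_le_of_degree_le hf0 (hdeg b)
  have key : homogenization f =
      ∑ b ∈ q.support, homogenizeTo f.totalDegree (q b * (b : MvPolynomial σ k)) := by
    rw [← homogenizeTo_sum _ hdeg', ← hf', homogenizeTo_totalDegree]
  rw [key]
  refine Ideal.sum_mem _ fun b hb => ?_
  rw [homogenizeTo_eq_X_pow_mul (hdeg' b hb), homogenization_mul]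
  exact Ideal.mul_mem_left _ _ (Ideal.mul_mem_left _ _ (Ideal.subset_span ⟨b, b.2.1, rfl⟩))

/-- In particular, for a graded order and a FINITE Gröbner basis, `I^h` is generated by finitely
many homogenized basis elements. [cite: CoxLittleOShea2007, Ch.8 §4 Thm. 4] -/
theorem idealHomogenization_eq_span_finset_of_isGroebnerBasis
    [DecidableEq (MvPolynomial (Option σ) k)] {m : MonomialOrder σ} (hm : IsGradedOrder m)
    {G : Finset (MvPolynomial σ k)} {I : Ideal (MvPolynomial σ k)}
    (hG : IsGroebnerBasis m (G : Set (MvPolynomial σ k)) I) :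
    idealHomogenization I =
      Ideal.span (G.image homogenization : Set (MvPolynomial (Option σ) k)) := by
  rw [idealHomogenization_eq_span_of_isGroebnerBasis hm hG, Finset.coe_image]

end Groebner

end Literature.RingTheory.MvPolynomial.IdealHomogenization
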